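/-
Copyright (c) 2026 the pub-hodgecm-mathlib formalisation cell (harness21).  Prover seat hodgecm-mathlib-LH7-p09 (g2), CLOSE-OUT ROSTER strike line L3∕L5 (Track A
«(D-RAM) FOUR-FRAME» squad F0∕P3c∕LH4 ∕ F0∕P3c∕LH7); β₂-BOARD v2 row (OFF) (lead LH7-p09 (g2); assembler LH4-p12 (g8) ED. 5 `…OffRowOfPiecesResidual`, sockets `hUlo`, `hDlo`);
helper lane on h413 = stmt-HodgeConjecture-24833 (count-neutral).  2026-09-05.
-/
import Summits.HodgeConjecture.HodgeConjecture.Theorems.F0P3cDyRamLowerLineOnShell        -- ★ p863269 (this seat): `latticeInLevel_sq_endoGL_sub_one_of_level` (the positive square token)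
import Summits.HodgeConjecture.HodgeConjecture.Theorems.F0P3cDyRamConeCellPresentation    -- ★ p862869 (this seat): the junction `exists_presentation_of_mem_levelSetDep`
import HarnessLib

/-!
# Crux `H413`, line LH4 «(D-RAM) FOUR-FRAME» — the (β₂) road (R-36), β₂-BOARD v2 row (OFF), sockets `hUlo` ∕ `hDlo` (and the row): «UNDER THE PRODUCT LETTER THE SHELL
# IS THE EXACT LEVEL» — on any cone cell whose depth letters satisfy `|μ|·|μ − ρμ| ≤ |ϖE^j(α − ρα)|·|ϖE|^b·|ϖE|^M` (with `γ` `(M − ℓ₀)`-close to `1`) the near-transvection shell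
# `(ℓ₀, M)` of every glued vertex is just «level exactly `ℓ₀`», so the two literals of `cellDiff(j, b)` (`M = m*` and `M = m_c`) carry the SAME shell conjunct

Cell `hodgecm-mathlib` (D-0151), FLOOR 0, crux item H413 = `stmt-HodgeConjecture-24833`, route of record `HCCMUnconditional`; squads F0∕P3c∕LH4 ∕ LH7; lane
`--supports stmt-HodgeConjecture-24833 --as helper` (count-neutral; pays NO tier-0 row).  THEOREMS ONLY (no `def`, no instance, no notation, no `sorry`, default heartbeats);
★-only imports; states NO law; (β₂) stays a HYPOTHESIS.  DATUM-FREE: ★ p861044∕p861305's block frame and the line model `(M, jE, ρ, Θ, α; φ, lam, h)` of ★ (C1), as in ★ p862869.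

WHY (LH4-p12 (g8)'s ED. 5 `cellDiff_offRow_eq_zero_of_pieces₅`: the (OFF) residue is `hL` + `hUlo` + `hDlo`).  ★ p863269∕★ p863399 removed the shell conjuncts of `hL` (the lower
line sits on level exactly `ℓ₀`).  On the UPPER line `j + m = jl + b` (`m < 2b`) the level of a glued vertex VARIES over the cell, so the shell conjunct cannot drop out; but its
SQUARE clause can: ★ p863269 §1 `latticeInLevel_sq_endoGL_sub_one_of_level` gives `LatticeInLevel ϖ M ((Γ − 1)²) L₃` from `LatticeInLevel ϖ ℓ₀ (Γ − 1) L₃` and the product letter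
`|μ|·|μ − ρμ| ≤ |cc(α − ρα)|·|Y|·|ϖE|^M` — which on the upper line reads `2(m − b) ≥ M`, i.e. EXACTLY the band `m_c + 2b ≤ 2m` of `hUlo`∕`hDlo` at `M = m_c ≥ m*`.  Hence:
* §1 `latticeNearTransvShell_iff_exactLevel_of_prod` — PER VERTEX (★ `…ShellLineModel` letters): under `ℓ₀ + k = M`, `|u₀₀ − 1| ≤ |ϖ^k|`, `|μ| ≤ |ϖE|^k` and the product letter,
  `LatticeNearTransvShell ϖ ℓ₀ M (Γ − 1) L₃ ↔ (LatticeInLevel ϖ ℓ₀ (Γ − 1) L₃ ∧ ¬ LatticeInLevel ϖ (ℓ₀ + 1) (Γ − 1) L₃)`.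
* §2 HEAD `levelSetDep_inter_shell_and_eq_exactLevel_of_prod` — THE FOLD through ★ p862869's junction (cell currency `cc = ϖE^j`, `|Y| = |ϖE|^b`): for every trailing predicate `P`,
  the subset of `levelSetDep(j, b; μ)` cut out by `(… ∧ (LatticeNearTransvShell ϖ ℓ₀ M (Γ − 1) L₃ ∧ P L₃))` EQUALS the subset cut out by
  `(… ∧ ((LatticeInLevel ϖ ℓ₀ (Γ − 1) L₃ ∧ ¬ LatticeInLevel ϖ (ℓ₀ + 1) (Γ − 1) L₃) ∧ P L₃))` — at `M := m*` and at `M := m_c` the two literals of `hUlo` (`b < j`) and of `hDlo`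
  (`j = b`) get the SAME, `M`-free shell conjunct; no `b < j` is used.
LETTERS (cell currency): `hmk : ℓ₀ + k = M`, `huk : |u₀₀ − 1| ≤ |ϖ^k|`, `hμk : |μ| ≤ |ϖE|^k`, `hprod : |μ|·|μ − ρμ| ≤ |ϖE^j·(α − ρα)|·|ϖE|^b·|ϖE|^M` (from `_hm`, `_hjl`, `|α − ρα| = 1`:
`m + jl ≥ j + b + M`; on the upper line `2(m − b) ≥ M`).
HONEST LABEL.  Count-neutral lattice bookkeeping; nothing printed is asserted; no census law is stated; `hUlo`, `hDlo`, `hL` stay OPEN; `HC_CM` is proved only modulo the 7 printed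
citations (2 remaining named inputs: hLiu418 = `stmt-HodgeConjecture-24832`, h413 = `stmt-HodgeConjecture-24833`) until rung 0 closes.
## References
* [Kottwitz1986BaseChangeUnits] R. E. Kottwitz, *Base change for unit elements of Hecke algebras*, Compositio Math. 60 (1986): §1 pp. 240–241, §3.
* [Jacobowitz1962] R. Jacobowitz, *Hermitian forms over local fields*, Amer. J. Math. 84 (1962): §4 (duals, modular components, gluing).
* [Rogawski1990] J. D. Rogawski, *Automorphic Representations of Unitary Groups in Three Variables*, Ann. of Math. Stud. 123 (1990): §4.9 Prop. 4.9.1 (b) p. 55.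
* [Serre1979] J.-P. Serre, *Local Fields*, GTM 67 (1979): Ch. III §6 Prop. 12 (orders of conductor `c`).
-/

set_option autoImplicit false

noncomputable section

namespace Summit.HodgeConjecture.HodgeConjecture.Cruxes.H413.F0P3cDyRamShellOfExactLevel

open scoped Valued WithZero Matrix MatrixGroups
open WithZero
open Literature.NumberTheory.Automorphic Literature.NumberTheory.Automorphic.HermitianLattice Literature.NumberTheory.Automorphic.UnitaryLatticeTree
open Literature.NumberTheory.Automorphic.EllipticPlaneAsFieldLine
open Literature.NumberTheory.Rogawski1990
open Summit.HodgeConjecture.HodgeConjecture.Cruxes.H413.F0P3cDyRamToricCensusDefs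
open Summit.HodgeConjecture.HodgeConjecture.Cruxes.H413.F0P3cDyRamFourFrameCensusDefs (LatticeInLevel LatticeNearTransvShell)
open Summit.HodgeConjecture.HodgeConjecture.Cruxes.H413.F0P3cDyRamBoundaryCellLetterCardTwo (v_map_lt_one_iff_of_le_iff)
open Summit.HodgeConjecture.HodgeConjecture.Cruxes.H413.F0P3cDyRamConeCellPresentation (exists_presentation_of_mem_levelSetDep)
open Summit.HodgeConjecture.HodgeConjecture.Cruxes.H413.F0P3cDyRamLowerLineOnShell (latticeInLevel_sq_endoGL_sub_one_of_level)

variable {E M : Type} [Field E] [Valued E ℤᵐ⁰] [Field M] [Valued M ℤᵐ⁰] {ρ Θ : M →+* M} {α : M}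

/-! ## §1 Per vertex: under the product letter the shell `(ℓ₀, M)` is the exact level `ℓ₀` -/

/-- **UNDER THE PRODUCT LETTER THE SHELL IS THE EXACT LEVEL.**  ★ `…ShellLineModel`'s glued-vertex letters VERBATIM + `Fix ρ ⊇ jE(E)`, `|jE c| ≤ 1 ↔ |c| ≤ 1`; CELL `hYb`; LETTERS
`hmk : ℓ₀ + k = M`, `huk : |u₀₀ − 1| ≤ |ϖ^k|`, `hμk : |lam − jE u₀₀| ≤ |ϖE|^k`, `hprod : |μ|·|μ − ρμ| ≤ |cc(α − ρα)|·|Y|·|ϖE|^M`.  THEN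
`LatticeNearTransvShell ϖ ℓ₀ M (Γ − 1) L₃ ↔ LatticeInLevel ϖ ℓ₀ (Γ − 1) L₃ ∧ ¬ LatticeInLevel ϖ (ℓ₀ + 1) (Γ − 1) L₃` (★ p863269 §1 supplies the square clause).
[cite: Kottwitz1986BaseChangeUnits, §3] [cite: Rogawski1990, §4.9 Prop. 4.9.1 (b) p. 55] [cite: Serre1979, Ch. III §6 Prop. 12] -/
theorem latticeNearTransvShell_iff_exactLevel_of_prod
    (hvρ : ∀ x, Valued.v (ρ x) = Valued.v x) {ϖ : E} (hϖ : Valued.v ϖ = exp (-1 : ℤ))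
    (jE : E →+* M) (hjv : ∀ c, Valued.v (jE c) ≤ 1 ↔ Valued.v c ≤ 1) (hjfix : ∀ z, ρ z = z ↔ ∃ c, jE c = z)
    (φ : (Fin 2 → E) →+ M) (hφs : ∀ (c : E) (x : Fin 2 → E), φ (c • x) = jE c * φ x) (hφi : Function.Injective φ)
    {γ₂ : GL (Fin 2) E} {lam : M} (hφγ : ∀ x, φ ((γ₂ : Matrix (Fin 2) (Fin 2) E) *ᵥ x) = lam * φ x)
    {L₃ : Submodule 𝒪[E] (Fin 3 → E)} {b : ℕ} (hb : ∀ a : E, (Pi.single 1 a : Fin 3 → E) ∈ L₃ ↔ Valued.v a ≤ Valued.v ϖ ^ b)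
    (hpr : ∀ x ∈ L₃, Valued.v (x 1) * Valued.v ϖ ^ b ≤ 1)
    {B₂ : Submodule 𝒪[E] (Fin 2 → E)} {w₀ : Fin 2 → E} {g₀ : Fin 3 → E}
    (hB : B₂.map ((Matrix.toLin' (!![1, 0; 0, 0; 0, 1] : Matrix (Fin 3) (Fin 2) E)).restrictScalars 𝒪[E]) =
      L₃ ⊓ LinearMap.ker ((LinearMap.proj (1 : Fin 3) : (Fin 3 → E) →ₗ[E] E).restrictScalars 𝒪[E]))
    (hg₀ : g₀ ∈ L₃) (hg₀1 : Valued.v (g₀ 1) * Valued.v ϖ ^ b = 1) (hprg : g₀ - Pi.single 1 (g₀ 1) = ![w₀ 0, 0, w₀ 1])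
    {Λ : AddSubgroup M} (hBΛ : B₂.toAddSubgroup.map φ = Λ) {cc x₀ Y : M} (hx₀ : x₀ ≠ 0)
    (hΛx : ∀ x, x ∈ Λ ↔ ∃ z, IsOrd ρ α cc z ∧ x = x₀ * z) (hw₀Y : φ w₀ = Y⁻¹ * x₀) (hYb : Valued.v Y = Valued.v (jE ϖ) ^ b)
    (u : GL (Fin 1) E) (ℓ₀ k Ms : ℕ) (hmk : ℓ₀ + k = Ms)
    (huk : Valued.v ((u : Matrix (Fin 1) (Fin 1) E) 0 0 - 1) ≤ Valued.v (ϖ ^ k))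
    (hμk : Valued.v (lam - jE ((u : Matrix (Fin 1) (Fin 1) E) 0 0)) ≤ Valued.v (jE ϖ) ^ k)
    (hprod : Valued.v (lam - jE ((u : Matrix (Fin 1) (Fin 1) E) 0 0)) * Valued.v ((lam - jE ((u : Matrix (Fin 1) (Fin 1) E) 0 0)) - ρ (lam - jE ((u : Matrix (Fin 1) (Fin 1) E) 0 0))) ≤
      Valued.v (cc * (α - ρ α)) * Valued.v Y * Valued.v (jE ϖ) ^ Ms) :
    LatticeNearTransvShell ϖ ℓ₀ Ms ((((endoGL (γ₂, u) : GL (Fin 3) E) : Matrix (Fin 3) (Fin 3) E) - 1)) L₃ ↔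
      (LatticeInLevel ϖ ℓ₀ ((((endoGL (γ₂, u) : GL (Fin 3) E) : Matrix (Fin 3) (Fin 3) E) - 1)) L₃ ∧
        ¬ LatticeInLevel ϖ (ℓ₀ + 1) ((((endoGL (γ₂, u) : GL (Fin 3) E) : Matrix (Fin 3) (Fin 3) E) - 1)) L₃) :=
  ⟨fun h => ⟨h.1, h.2.1⟩, fun h => ⟨h.1, h.2,
    latticeInLevel_sq_endoGL_sub_one_of_level hvρ hϖ jE hjv hjfix φ hφs hφi hφγ hb hpr hB hg₀ hg₀1 hprg hBΛ hx₀ hΛx hw₀Y hYb u ℓ₀ k Ms hmk h.1 huk hμk hprod⟩⟩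

/-! ## §2 THE FOLD: under the product letter the square conjunct drops out of the cell's labelled subsets -/

/-- **FOLD — «UNDER THE PRODUCT LETTER THE SHELL CONJUNCT IS THE EXACT LEVEL».**  Block frame + line model (★ (C1) letters, `|jE c| ≤ 1 ↔ |c| ≤ 1`, `Fix ρ = jE(E)`), literal
`(γ₂, u)`; cone cell `(j, b)` with `1 ≤ b`, `lam ∈ 𝒪_j` (no `b < j`, no `b ≤ j`); LETTERS on `μ = lam − jE u₀₀`: `hmk : ℓ₀ + k = M`, `huk : |u₀₀ − 1| ≤ |ϖ^k|`, `hμk : |μ| ≤ |ϖE|^k`,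
`hprod : |μ|·|μ − ρμ| ≤ |ϖE^j(α − ρα)|·|ϖE|^b·|ϖE|^M`.  THEN for every trailing predicate `P`:
`levelSetDep ∩ {∃ B, φB = Λ ∧ ∃ L₃, SD ∧ L₃ ∩ W = ι_W B ∧ tube_b ∧ (LatticeNearTransvShell ϖ ℓ₀ M (Γ − 1) L₃ ∧ P L₃)}
 = levelSetDep ∩ {∃ B, φB = Λ ∧ ∃ L₃, SD ∧ L₃ ∩ W = ι_W B ∧ tube_b ∧ ((LatticeInLevel ϖ ℓ₀ (Γ − 1) L₃ ∧ ¬ LatticeInLevel ϖ (ℓ₀ + 1) (Γ − 1) L₃) ∧ P L₃)}`.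
[cite: Kottwitz1986BaseChangeUnits, §1 pp. 240–241; §3] [cite: Jacobowitz1962, §4] [cite: Rogawski1990, §4.9 Prop. 4.9.1 (b) p. 55] -/
theorem levelSetDep_inter_shell_and_eq_exactLevel_of_prod
    (σ : E →+* E) (hσ : ∀ a, σ (σ a) = a) (hvσ : ∀ a, Valued.v (σ a) = Valued.v a) {ϖ : E} (hϖ : Valued.v ϖ = exp (-1 : ℤ))
    {H₂ : Matrix (Fin 2) (Fin 2) E} (hH₂ : IsUnit H₂.det) (hH₂σ : (H₂.map σ)ᵀ = H₂) {hW : E} (hhW : Valued.v hW = 1)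
    (jE : E →+* M) (hρρ : ∀ x, ρ (ρ x) = x) (hvρ : ∀ x, Valued.v (ρ x) = Valued.v x) (hα : ρ α ≠ α) (hα1 : Valued.v α ≤ 1)
    (hint : ∀ z : M, Valued.v z ≤ 1 → Valued.v ((z - ρ z) / (α - ρ α)) ≤ 1)
    (hΘΘ : ∀ x, Θ (Θ x) = x) (hΘρ : ∀ x, Θ (ρ x) = ρ (Θ x)) (hvΘ : ∀ x, Valued.v (Θ x) = Valued.v x)
    (hjv : ∀ c, Valued.v (jE c) ≤ 1 ↔ Valued.v c ≤ 1) (hjfix : ∀ z, ρ z = z ↔ ∃ c, jE c = z)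
    (hjpow : ∀ (t : E) (n : ℤ), Valued.v (jE t) = Valued.v (jE ϖ) ^ n ↔ Valued.v t = Valued.v ϖ ^ n)
    (hϖmax : ∀ t : M, ρ t = t → Valued.v t < 1 → Valued.v t ≤ Valued.v (jE ϖ))
    (φ : (Fin 2 → E) →+ M) (hφs : ∀ (c : E) (x : Fin 2 → E), φ (c • x) = jE c * φ x) (hφi : Function.Injective φ) (hφo : Function.Surjective φ)
    {γ₂ : GL (Fin 2) E} {lam h : M} (hφγ : ∀ x, φ ((γ₂ : Matrix (Fin 2) (Fin 2) E).mulVec x) = lam * φ x) (hlam : Valued.v lam = 1)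
    (hΘh : Θ h = h) (hh : h ≠ 0) (hform : ∀ x y, jE (pairing σ H₂ x y) = h * Θ (φ x) * φ y + ρ (h * Θ (φ x) * φ y))
    (u : GL (Fin 1) E) (ℓ₀ k Ms : ℕ) (hmk : ℓ₀ + k = Ms)
    (huk : Valued.v ((u : Matrix (Fin 1) (Fin 1) E) 0 0 - 1) ≤ Valued.v (ϖ ^ k))
    {b j : ℕ} (hb1 : 1 ≤ b) (hlamj : IsOrd ρ α (jE ϖ ^ j) lam)
    (hμk : Valued.v (lam - jE ((u : Matrix (Fin 1) (Fin 1) E) 0 0)) ≤ Valued.v (jE ϖ) ^ k)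
    (hprod : Valued.v (lam - jE ((u : Matrix (Fin 1) (Fin 1) E) 0 0)) * Valued.v ((lam - jE ((u : Matrix (Fin 1) (Fin 1) E) 0 0)) - ρ (lam - jE ((u : Matrix (Fin 1) (Fin 1) E) 0 0))) ≤
      Valued.v (jE ϖ ^ j * (α - ρ α)) * Valued.v (jE ϖ) ^ b * Valued.v (jE ϖ) ^ Ms)
    (P : Submodule 𝒪[E] (Fin 3 → E) → Prop) :
    levelSetDep ρ Θ α (jE ϖ) h j b (lam - jE ((u : Matrix (Fin 1) (Fin 1) E) 0 0)) ∩
        {Λ | ∃ B : Submodule 𝒪[E] (Fin 2 → E), B.toAddSubgroup.map φ = Λ ∧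
          ∃ L₃ : Submodule 𝒪[E] (Fin 3 → E), IsSelfDualLattice σ ϖ (!![H₂ 0 0, 0, H₂ 0 1; 0, hW, 0; H₂ 1 0, 0, H₂ 1 1] : Matrix (Fin 3) (Fin 3) E) L₃ ∧
            L₃ ⊓ LinearMap.ker ((LinearMap.proj (1 : Fin 3) : (Fin 3 → E) →ₗ[E] E).restrictScalars 𝒪[E]) =
              B.map ((Matrix.toLin' (!![1, 0; 0, 0; 0, 1] : Matrix (Fin 3) (Fin 2) E)).restrictScalars 𝒪[E]) ∧
            (∀ c : E, (Pi.single 1 c : Fin 3 → E) ∈ L₃ ↔ Valued.v c ≤ Valued.v ϖ ^ b) ∧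
            (LatticeNearTransvShell ϖ ℓ₀ Ms ((((endoGL (γ₂, u) : GL (Fin 3) E) : Matrix (Fin 3) (Fin 3) E) - 1)) L₃ ∧ P L₃)} =
      levelSetDep ρ Θ α (jE ϖ) h j b (lam - jE ((u : Matrix (Fin 1) (Fin 1) E) 0 0)) ∩
        {Λ | ∃ B : Submodule 𝒪[E] (Fin 2 → E), B.toAddSubgroup.map φ = Λ ∧
          ∃ L₃ : Submodule 𝒪[E] (Fin 3 → E), IsSelfDualLattice σ ϖ (!![H₂ 0 0, 0, H₂ 0 1; 0, hW, 0; H₂ 1 0, 0, H₂ 1 1] : Matrix (Fin 3) (Fin 3) E) L₃ ∧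
            L₃ ⊓ LinearMap.ker ((LinearMap.proj (1 : Fin 3) : (Fin 3 → E) →ₗ[E] E).restrictScalars 𝒪[E]) =
              B.map ((Matrix.toLin' (!![1, 0; 0, 0; 0, 1] : Matrix (Fin 3) (Fin 2) E)).restrictScalars 𝒪[E]) ∧
            (∀ c : E, (Pi.single 1 c : Fin 3 → E) ∈ L₃ ↔ Valued.v c ≤ Valued.v ϖ ^ b) ∧
            ((LatticeInLevel ϖ ℓ₀ ((((endoGL (γ₂, u) : GL (Fin 3) E) : Matrix (Fin 3) (Fin 3) E) - 1)) L₃ ∧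
              ¬ LatticeInLevel ϖ (ℓ₀ + 1) ((((endoGL (γ₂, u) : GL (Fin 3) E) : Matrix (Fin 3) (Fin 3) E) - 1)) L₃) ∧ P L₃)} := by
  -- per member and glued vertex, the shell is the exact level
  have key : ∀ Λ, Λ ∈ levelSetDep ρ Θ α (jE ϖ) h j b (lam - jE ((u : Matrix (Fin 1) (Fin 1) E) 0 0)) →
      ∀ B : Submodule 𝒪[E] (Fin 2 → E), B.toAddSubgroup.map φ = Λ →
      ∀ L₃ : Submodule 𝒪[E] (Fin 3 → E), IsSelfDualLattice σ ϖ (!![H₂ 0 0, 0, H₂ 0 1; 0, hW, 0; H₂ 1 0, 0, H₂ 1 1] : Matrix (Fin 3) (Fin 3) E) L₃ →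
        L₃ ⊓ LinearMap.ker ((LinearMap.proj (1 : Fin 3) : (Fin 3 → E) →ₗ[E] E).restrictScalars 𝒪[E]) =
          B.map ((Matrix.toLin' (!![1, 0; 0, 0; 0, 1] : Matrix (Fin 3) (Fin 2) E)).restrictScalars 𝒪[E]) →
        (∀ c : E, (Pi.single 1 c : Fin 3 → E) ∈ L₃ ↔ Valued.v c ≤ Valued.v ϖ ^ b) →
        (LatticeNearTransvShell ϖ ℓ₀ Ms ((((endoGL (γ₂, u) : GL (Fin 3) E) : Matrix (Fin 3) (Fin 3) E) - 1)) L₃ ↔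
          (LatticeInLevel ϖ ℓ₀ ((((endoGL (γ₂, u) : GL (Fin 3) E) : Matrix (Fin 3) (Fin 3) E) - 1)) L₃ ∧
            ¬ LatticeInLevel ϖ (ℓ₀ + 1) ((((endoGL (γ₂, u) : GL (Fin 3) E) : Matrix (Fin 3) (Fin 3) E) - 1)) L₃)) := by
    intro Λ hΛ B hBΛ L₃ hL hLB htube
    obtain ⟨x₀, w₀, g₀, hx₀, hΛx, -, -, hylev, hw₀Y, hpr, hg₀, hg₀1, hprg⟩ :=
      exists_presentation_of_mem_levelSetDep σ hσ hvσ hϖ hH₂ hH₂σ hhW jE hρρ hvρ hα hα1 hint hΘΘ hΘρ hvΘ hjv hjfix hjpow hϖmax φ hφs hφi hφo hφγ hlam hΘh hh hform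
        ((u : Matrix (Fin 1) (Fin 1) E) 0 0) hb1 hlamj hΛ hBΛ hL hLB htube
    have hprod' : Valued.v (lam - jE ((u : Matrix (Fin 1) (Fin 1) E) 0 0)) *
        Valued.v ((lam - jE ((u : Matrix (Fin 1) (Fin 1) E) 0 0)) - ρ (lam - jE ((u : Matrix (Fin 1) (Fin 1) E) 0 0))) ≤
        Valued.v (jE ϖ ^ j * (α - ρ α)) * Valued.v (dualGen ρ Θ α (jE ϖ ^ j) h x₀) * Valued.v (jE ϖ) ^ Ms := by rw [hylev]; exact hprod
    exact latticeNearTransvShell_iff_exactLevel_of_prod hvρ hϖ jE hjv hjfix φ hφs hφi hφγ htube hpr hLB.symm hg₀ hg₀1 hprg hBΛ hx₀ hΛx hw₀Y hylev u ℓ₀ k Ms hmk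
      huk hμk hprod'
  ext Λ
  constructor
  · rintro ⟨hΛ, B, hBΛ, L₃, hL, hLB, htube, hshell, hP⟩
    exact ⟨hΛ, B, hBΛ, L₃, hL, hLB, htube, (key Λ hΛ B hBΛ L₃ hL hLB htube).1 hshell, hP⟩
  · rintro ⟨hΛ, B, hBΛ, L₃, hL, hLB, htube, hlev, hP⟩
    exact ⟨hΛ, B, hBΛ, L₃, hL, hLB, htube, (key Λ hΛ B hBΛ L₃ hL hLB htube).2 hlev, hP⟩

end Summit.HodgeConjecture.HodgeConjecture.Cruxes.H413.F0P3cDyRamShellOfExactLevel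

end
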